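import Mathlib.Geometry.Manifold.HasGroupoid
import HarnessLib

/-!
# Atlases on open subsets of a fixed space: restriction, gluing, transport, limits

Topic `Literature/Geometry/Manifold`. Book-keeping for arguments that build a smooth (or, more
generally, `G`-) structure on a topological manifold *piece by piece* — the classical existence
proofs of smooth structures on topological surfaces and `3`-manifolds (T. Radó 1925; E. E. Moise,
*Geometric topology in dimensions 2 and 3* (1977), Ch. 8 and §§ 34–36; A. Hatcher, *The Kirby
torus trick for surfaces*, arXiv:1312.3518, proof of Thm. A: "We build a smooth structure on
`Uₙ = ⋃_{i ≤ n} hᵢ(ℝ²)` by induction on `n` … extend the smooth structure from `U_{n-1}` to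
`Uₙ`"), where the structure lives on a growing open subset of a fixed topological space `X` and
is modified on overlaps. Mathlib's `ChartedSpace` is a class on a *type*, which makes "a
structure on the open subset `U`, then on `U ∪ V`" awkward (subtypes of subtypes); here a
structure is plain data on `X`:

* `AtlasOn G W` — a set of partial homeomorphisms `X ⇀ H` with sources inside `W`, covering `W`,
  pairwise `G`-compatible (`G` a structure groupoid on the model `H`);
* `StructureGroupoid.symm_trans_mem_of_forall` — **compatibility is local**: `e⁻¹ ≫ e' ∈ G` as
  soon as every point of `e.source ∩ e'.source` lies in a chart `f` with `e⁻¹ ≫ f ∈ G` and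
  `f⁻¹ ≫ e' ∈ G` (locality and composition in `G`);
* `AtlasOn.AgreeOn 𝒜 ℬ O` — two atlases define the same structure over the open set `O`;
  reflexive, symmetric, monotone in `O`, and transitive over the part of `O` covered by the
  middle atlas (`AgreeOn.trans`);
* `AtlasOn.restrict` (to an open subset), `AtlasOn.union` (**gluing** two atlases that agree on
  the overlap), `AtlasOn.pullback` along a partial homeomorphism `X' ⇀ X` (charts `φ ≫ e`; in
  particular transport along homeomorphisms and reading a structure in a chart),
  `AtlasOn.ofChartedSpace`, and conversely `AtlasOn.chartedSpace` / `AtlasOn.hasGroupoid` — an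
  atlas on `univ` *is* a `ChartedSpace` structure with `HasGroupoid`;
* `AtlasOn.limit` — **locally eventually constant families glue**: given atlases `𝒜 i` and, for
  every point, an index `N x` and an open neighbourhood `V x` over which all later atlases agree
  with `𝒜 (N x)`, the restrictions `e|V x`, `e ∈ 𝒜 (N x)`, form an atlas on `⋃ V x`
  (Hatcher, loc. cit.; Milnor, *Lectures on the h-cobordism theorem* (1965), proof of Thm. 2.7,
  the same limiting device for functions).

Everything is proved; no named facts. Requires `ClosedUnderRestriction G` where restrictions
occur (true for `contDiffGroupoid`, Mathlib). The lemmas `StructureGroupoid.symm_trans_mem_of_forall`,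
`….symm_trans_mem_symm`, `….ofSet_mem`, `….symm_trans_self_mem`, `….symm_trans_restr_mem`,
`….restr_symm_trans_restr_mem` are deliberate dot-notation extensions of Mathlib's
`StructureGroupoid`.
-/

noncomputable section

open Set OpenPartialHomeomorph
open scoped Manifold Topology

namespace Literature.Geometry.Manifold

variable {X : Type*} [TopologicalSpace X] {X' : Type*} [TopologicalSpace X']
  {H : Type*} [TopologicalSpace H] {G : StructureGroupoid H}

/-! ### Compatibility of two charts is a local property -/

/-- The composite `(e⁻¹ ≫ f) ≫ (f⁻¹ ≫ e')` is the restriction of `e⁻¹ ≫ e'` to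
`e.target ∩ e⁻¹(f.source)`. [folklore] -/
theorem symm_trans_trans_symm_trans_eqOnSource (e e' f : OpenPartialHomeomorph X H) :
    (e.symm ≫ₕ f) ≫ₕ (f.symm ≫ₕ e') ≈
      (e.symm ≫ₕ e').restr (e.target ∩ e.symm ⁻¹' f.source) := by
  have hs : IsOpen (e.target ∩ e.symm ⁻¹' f.source) := e.isOpen_inter_preimage_symm f.open_source
  constructor
  · ext y
    simp only [trans_source, symm_source, coe_trans, Function.comp_apply, mem_inter_iff, mem_preimage,
      restr_source' _ _ hs]
    constructor
    · rintro ⟨⟨hy, hyf⟩, hft, hfe'⟩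
      rw [f.left_inv hyf] at hfe'
      exact ⟨⟨hy, hfe'⟩, hy, hyf⟩
    · rintro ⟨⟨hy, hye'⟩, -, hyf⟩
      refine ⟨⟨hy, hyf⟩, f.map_source hyf, ?_⟩
      rw [f.left_inv hyf]; exact hye'
  · intro y hy
    simp only [trans_source, symm_source, coe_trans, Function.comp_apply, mem_inter_iff, mem_preimage] at hy
    simp only [coe_trans, Function.comp_apply, restr_apply]
    rw [f.left_inv hy.1.2]

/-- **Compatibility is local.** If every point of `e.source ∩ e'.source` lies in the source of
some chart `f` with `e⁻¹ ≫ f ∈ G` and `f⁻¹ ≫ e' ∈ G`, then `e⁻¹ ≫ e' ∈ G` (locality of the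
structure groupoid). [folklore] -/
theorem _root_.StructureGroupoid.symm_trans_mem_of_forall (G : StructureGroupoid H)
    {e e' : OpenPartialHomeomorph X H}
    (h : ∀ x ∈ e.source ∩ e'.source, ∃ f : OpenPartialHomeomorph X H,
      x ∈ f.source ∧ e.symm ≫ₕ f ∈ G ∧ f.symm ≫ₕ e' ∈ G) :
    e.symm ≫ₕ e' ∈ G := by
  refine G.locality fun y hy => ?_
  simp only [trans_source, symm_source, mem_inter_iff, mem_preimage] at hy
  obtain ⟨f, hxf, hA, hB⟩ := h (e.symm y) ⟨e.map_target hy.1, hy.2⟩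
  refine ⟨e.target ∩ e.symm ⁻¹' f.source, e.isOpen_inter_preimage_symm f.open_source, ⟨hy.1, hxf⟩, ?_⟩
  exact G.mem_of_eqOnSource (G.trans hA hB) (Setoid.symm (symm_trans_trans_symm_trans_eqOnSource e e' f))

/-- Symmetry of compatibility: `e⁻¹ ≫ e' ∈ G → e'⁻¹ ≫ e ∈ G`. [folklore] -/
theorem _root_.StructureGroupoid.symm_trans_mem_symm (G : StructureGroupoid H) {e e' : OpenPartialHomeomorph X H}
    (h : e.symm ≫ₕ e' ∈ G) : e'.symm ≫ₕ e ∈ G := by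
  have := G.symm h
  rwa [trans_symm_eq_symm_trans_symm, symm_symm] at this

/-- In a restriction-closed groupoid, identities of open sets are members. [folklore] -/
theorem _root_.StructureGroupoid.ofSet_mem (G : StructureGroupoid H) [ClosedUnderRestriction G]
    {s : Set H} (hs : IsOpen s) : OpenPartialHomeomorph.ofSet s hs ∈ G :=
  (closedUnderRestriction_iff_id_le G).1 ‹_› (idRestrGroupoid_mem hs)

/-- Every chart is compatible with itself (restriction-closed groupoid). [folklore] -/
theorem _root_.StructureGroupoid.symm_trans_self_mem (G : StructureGroupoid H) [ClosedUnderRestriction G]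
    (e : OpenPartialHomeomorph X H) : e.symm ≫ₕ e ∈ G :=
  G.mem_of_eqOnSource (G.ofSet_mem e.open_target) (symm_trans_self e)

/-- Compatibility passes to restrictions of the second chart. [folklore] -/
theorem _root_.StructureGroupoid.symm_trans_restr_mem (G : StructureGroupoid H) [ClosedUnderRestriction G]
    {e e' : OpenPartialHomeomorph X H} (h : e.symm ≫ₕ e' ∈ G) {s : Set X} (hs : IsOpen s) :
    e.symm ≫ₕ e'.restr s ∈ G := by
  have hO : IsOpen (e.target ∩ e.symm ⁻¹' s) := e.isOpen_inter_preimage_symm hs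
  have h1 : e.symm ≫ₕ e'.restr s = (e.symm ≫ₕ e').restr (e.symm ⁻¹' s) := by
    rw [← ofSet_trans e' hs, ← trans_assoc, trans_ofSet, restr_trans]
  have h2 : (e.symm ≫ₕ e').restr (e.symm ⁻¹' s) = (e.symm ≫ₕ e').restr (e.target ∩ e.symm ⁻¹' s) := by
    rw [← restr_source_inter (e.symm ≫ₕ e') (e.symm ⁻¹' s),
      ← restr_source_inter (e.symm ≫ₕ e') (e.target ∩ e.symm ⁻¹' s)]
    congr 1
    ext y
    simp only [trans_source, symm_source, mem_inter_iff, mem_preimage]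
    tauto
  rw [h1, h2]
  exact closedUnderRestriction' h hO

/-- Compatibility passes to restrictions of both charts. [folklore] -/
theorem _root_.StructureGroupoid.restr_symm_trans_restr_mem (G : StructureGroupoid H) [ClosedUnderRestriction G]
    {e e' : OpenPartialHomeomorph X H} (h : e.symm ≫ₕ e' ∈ G) {s : Set X} (hs : IsOpen s)
    {s' : Set X} (hs' : IsOpen s') : (e.restr s).symm ≫ₕ e'.restr s' ∈ G := by
  have h1 : e.symm ≫ₕ e'.restr s' ∈ G := G.symm_trans_restr_mem h hs'
  have h2 : (e'.restr s').symm ≫ₕ e.restr s ∈ G := G.symm_trans_restr_mem (G.symm_trans_mem_symm h1) hs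
  exact G.symm_trans_mem_symm h2

/-- Iterated restriction to open sets: `(e|O)|O' ≈ e|(O ∩ O')`. [folklore] -/
theorem restr_restr_eqOnSource {Y : Type*} [TopologicalSpace Y] (e : OpenPartialHomeomorph X Y)
    {O O' : Set X} (hO : IsOpen O) (hO' : IsOpen O') : (e.restr O).restr O' ≈ e.restr (O ∩ O') := by
  constructor
  · simp only [restr_source' _ _ hO, restr_source' _ _ hO', restr_source' _ _ (hO.inter hO'), inter_assoc]
  · intro x _
    simp only [restr_apply]

/-! ### Atlases on open subsets -/

variable (G) in
/-- **An atlas of `G`-compatible charts on the subset `W ⊆ X`**: a set of partial homeomorphisms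
`X ⇀ H` whose sources lie in `W` and cover it, any two of which have their transition map in
the structure groupoid `G`. (For `W = univ` this is the data of `ChartedSpace H X` together with
`HasGroupoid X G`, see `AtlasOn.chartedSpace`.) [folklore] -/
structure AtlasOn (W : Set X) where
  /-- The charts. -/
  charts : Set (OpenPartialHomeomorph X H)
  source_subset : ∀ e ∈ charts, e.source ⊆ W
  cover : ∀ x ∈ W, ∃ e ∈ charts, x ∈ e.source
  compatible : ∀ e ∈ charts, ∀ e' ∈ charts, e.symm ≫ₕ e' ∈ G

namespace AtlasOn

variable {U V W O : Set X}

/-- The carrier of an atlas is the union of the sources of its charts. [folklore] -/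
theorem eq_iUnion (𝒜 : AtlasOn G W) : W = ⋃ e ∈ 𝒜.charts, e.source := by
  refine Subset.antisymm (fun x hx => ?_) (iUnion₂_subset 𝒜.source_subset)
  obtain ⟨e, he, hxe⟩ := 𝒜.cover x hx
  exact mem_iUnion₂.2 ⟨e, he, hxe⟩

/-- The carrier of an atlas is open. [folklore] -/
theorem isOpen (𝒜 : AtlasOn G W) : IsOpen W := by
  rw [𝒜.eq_iUnion]
  exact isOpen_biUnion fun e _ => e.open_source

/-- The same atlas on an equal carrier. [folklore] -/
def copy (𝒜 : AtlasOn G W) (hW : W = V) : AtlasOn G V where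
  charts := 𝒜.charts
  source_subset := hW ▸ 𝒜.source_subset
  cover := hW ▸ 𝒜.cover
  compatible := 𝒜.compatible

/-- The charts of the copied atlas. [folklore] -/
@[simp] theorem copy_charts (𝒜 : AtlasOn G W) (hW : W = V) : (𝒜.copy hW).charts = 𝒜.charts := rfl

/-- **The atlas of a charted space with structure groupoid `G`.** [folklore] -/
def ofChartedSpace [ChartedSpace H X] [HasGroupoid X G] : AtlasOn G (univ : Set X) where
  charts := atlas H X
  source_subset _ _ := subset_univ _
  cover x _ := ⟨chartAt H x, chart_mem_atlas H x, mem_chart_source H x⟩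
  compatible _ he _ he' := G.compatible he he'

/-- The atlas consisting of a single chart. [folklore] -/
def singleton [ClosedUnderRestriction G] (e : OpenPartialHomeomorph X H) : AtlasOn G e.source where
  charts := {e}
  source_subset := by simp
  cover x hx := ⟨e, rfl, hx⟩
  compatible := by
    rintro _ rfl _ rfl
    exact G.symm_trans_self_mem _

/-- The charts of the singleton atlas. [folklore] -/
@[simp] theorem singleton_charts [ClosedUnderRestriction G] (e : OpenPartialHomeomorph X H) :
    (singleton e : AtlasOn G e.source).charts = {e} := rfl

/-! #### The charted space of an atlas on the whole space -/

/-- **An atlas on `univ` is a charted-space structure** (the chart at `x` is chosen among those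
containing `x`). [folklore] -/
@[reducible] def chartedSpace (𝒜 : AtlasOn G (univ : Set X)) : ChartedSpace H X where
  atlas := 𝒜.charts
  chartAt x := (𝒜.cover x (mem_univ x)).choose
  mem_chart_source x := (𝒜.cover x (mem_univ x)).choose_spec.2
  chart_mem_atlas x := (𝒜.cover x (mem_univ x)).choose_spec.1

/-- The charted space of an atlas on `univ` has structure groupoid `G`. [folklore] -/
theorem hasGroupoid (𝒜 : AtlasOn G (univ : Set X)) : @HasGroupoid _ _ _ _ 𝒜.chartedSpace G :=
  @HasGroupoid.mk _ _ _ _ 𝒜.chartedSpace G fun he he' => 𝒜.compatible _ he _ he'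

/-! #### The charted space of an atlas on the subtype of its carrier -/

/-- The carrier of an atlas as an open subset. [folklore] -/
def opens (𝒜 : AtlasOn G W) : TopologicalSpace.Opens X := ⟨W, 𝒜.isOpen⟩

/-- The carrier of `𝒜.opens` is `W`. [folklore] -/
@[simp] theorem coe_opens (𝒜 : AtlasOn G W) : (𝒜.opens : Set X) = W := rfl

/-- A chart of the atlas at a point of the carrier (chosen). [folklore] -/
def chartAt' (𝒜 : AtlasOn G W) (x : 𝒜.opens) : OpenPartialHomeomorph X H := (𝒜.cover x.1 x.2).choose

/-- The chosen chart belongs to the atlas. [folklore] -/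
theorem chartAt'_mem (𝒜 : AtlasOn G W) (x : 𝒜.opens) : 𝒜.chartAt' x ∈ 𝒜.charts :=
  (𝒜.cover x.1 x.2).choose_spec.1

/-- The chosen chart contains the point. [folklore] -/
theorem mem_chartAt'_source (𝒜 : AtlasOn G W) (x : 𝒜.opens) : x.1 ∈ (𝒜.chartAt' x).source :=
  (𝒜.cover x.1 x.2).choose_spec.2

/-- **An atlas on `W` makes the open subspace `𝒜.opens = W` a charted space**, with charts the
restrictions to the subtype of (chosen) charts of the atlas (as Mathlib's charted-space structure
on an open subset of a charted space, `TopologicalSpace.Opens.instChartedSpace`). [folklore] -/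
@[reducible] def subtypeChartedSpace (𝒜 : AtlasOn G W) : ChartedSpace H 𝒜.opens where
  atlas := ⋃ x : 𝒜.opens, {(𝒜.chartAt' x).subtypeRestr ⟨x⟩}
  chartAt x := (𝒜.chartAt' x).subtypeRestr ⟨x⟩
  mem_chart_source x := by
    rw [subtypeRestr_source]
    exact 𝒜.mem_chartAt'_source x
  chart_mem_atlas x := mem_iUnion.2 ⟨x, rfl⟩

/-- The charted space `𝒜.opens` of an atlas has structure groupoid `G` (restriction-closed `G`).
[folklore] -/
theorem subtypeHasGroupoid [ClosedUnderRestriction G] (𝒜 : AtlasOn G W) :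
    @HasGroupoid _ _ _ _ 𝒜.subtypeChartedSpace G := by
  letI := 𝒜.subtypeChartedSpace
  refine ⟨?_⟩
  rintro e e' ⟨_, ⟨x, rfl⟩, he⟩ ⟨_, ⟨x', rfl⟩, he'⟩
  rw [mem_singleton_iff] at he he'
  rw [he, he']
  refine G.mem_of_eqOnSource ?_ (subtypeRestr_symm_trans_subtypeRestr (s := 𝒜.opens) _ (𝒜.chartAt' x) (𝒜.chartAt' x'))
  exact closedUnderRestriction' (𝒜.compatible _ (𝒜.chartAt'_mem x) _ (𝒜.chartAt'_mem x'))
    ((𝒜.chartAt' x).isOpen_inter_preimage_symm 𝒜.opens.2)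

/-- In the charted space `𝒜.opens` of an atlas, the preferred chart at `x` is the restriction of
the chosen chart of the atlas: `chartAt x = (chartAt' x)|W`. [folklore] -/
theorem subtype_chartAt_eq (𝒜 : AtlasOn G W) (x : 𝒜.opens) :
    @chartAt H _ 𝒜.opens _ 𝒜.subtypeChartedSpace x = (𝒜.chartAt' x).subtypeRestr ⟨x⟩ := rfl

/-! #### Compatibility of a chart with an atlas -/

/-- A chart `e` is **compatible** with the atlas `𝒜` when its transition maps with all charts
of `𝒜` lie in `G`. [folklore] -/
def Compat (𝒜 : AtlasOn G W) (e : OpenPartialHomeomorph X H) : Prop :=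
  ∀ e' ∈ 𝒜.charts, e.symm ≫ₕ e' ∈ G ∧ e'.symm ≫ₕ e ∈ G

/-- Charts of the atlas are compatible with it. [folklore] -/
theorem compat_of_mem (𝒜 : AtlasOn G W) {e : OpenPartialHomeomorph X H} (he : e ∈ 𝒜.charts) :
    𝒜.Compat e := fun e' he' => ⟨𝒜.compatible e he e' he', 𝒜.compatible e' he' e he⟩

/-- **Two charts compatible with an atlas covering their common source are compatible with each
other** (compatibility is local). [folklore] -/
theorem Compat.symm_trans_mem {𝒜 : AtlasOn G W} {e e' : OpenPartialHomeomorph X H} (he : 𝒜.Compat e)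
    (he' : 𝒜.Compat e') (h : e.source ∩ e'.source ⊆ W) : e.symm ≫ₕ e' ∈ G := by
  refine G.symm_trans_mem_of_forall fun x hx => ?_
  obtain ⟨f, hf, hxf⟩ := 𝒜.cover x (h hx)
  exact ⟨f, hxf, (he f hf).1, (he' f hf).2⟩

/-- Restrictions of compatible charts are compatible (restriction-closed groupoid). [folklore] -/
theorem Compat.restr [ClosedUnderRestriction G] {𝒜 : AtlasOn G W} {e : OpenPartialHomeomorph X H}
    (he : 𝒜.Compat e) {s : Set X} (hs : IsOpen s) : 𝒜.Compat (e.restr s) := fun e' he' =>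
  ⟨by simpa using G.restr_symm_trans_restr_mem (he e' he').1 hs isOpen_univ,
   G.symm_trans_restr_mem (he e' he').2 hs⟩

/-- Adding a compatible chart to an atlas. [folklore] -/
def insert (𝒜 : AtlasOn G W) (e : OpenPartialHomeomorph X H) (he : 𝒜.Compat e)
    (hee : e.symm ≫ₕ e ∈ G) : AtlasOn G (W ∪ e.source) where
  charts := Set.insert e 𝒜.charts
  source_subset := by
    rintro f (rfl | hf)
    · exact subset_union_right
    · exact (𝒜.source_subset f hf).trans subset_union_left
  cover := by
    rintro x (hx | hx)
    · obtain ⟨f, hf, hxf⟩ := 𝒜.cover x hx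
      exact ⟨f, Or.inr hf, hxf⟩
    · exact ⟨e, Or.inl rfl, hx⟩
  compatible := by
    rintro f (rfl | hf) f' (rfl | hf')
    · exact hee
    · exact (he f' hf').1
    · exact (he f hf).2
    · exact 𝒜.compatible f hf f' hf'

/-! #### Agreement of two atlases over an open set -/

/-- **Two atlases agree over `O`**: every chart of one is compatible with every chart of the
other after restriction to `O` (both transition maps in `G`). Meaningful for open `O`.
[folklore] -/
def AgreeOn (𝒜 : AtlasOn G U) (ℬ : AtlasOn G V) (O : Set X) : Prop :=
  ∀ e ∈ 𝒜.charts, ∀ e' ∈ ℬ.charts, e.symm ≫ₕ e'.restr O ∈ G ∧ e'.symm ≫ₕ e.restr O ∈ G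

/-- Agreement is symmetric. [folklore] -/
theorem AgreeOn.symm {𝒜 : AtlasOn G U} {ℬ : AtlasOn G V} (h : 𝒜.AgreeOn ℬ O) : ℬ.AgreeOn 𝒜 O :=
  fun e' he' e he => ⟨(h e he e' he').2, (h e he e' he').1⟩

/-- An atlas agrees with itself over every open set. [folklore] -/
theorem AgreeOn.rfl [ClosedUnderRestriction G] {𝒜 : AtlasOn G U} (hO : IsOpen O) : 𝒜.AgreeOn 𝒜 O :=
  fun e he e' he' => ⟨G.symm_trans_restr_mem (𝒜.compatible e he e' he') hO,
    G.symm_trans_restr_mem (𝒜.compatible e' he' e he) hO⟩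

/-- Agreement is monotone in the open set. [folklore] -/
theorem AgreeOn.mono [ClosedUnderRestriction G] {𝒜 : AtlasOn G U} {ℬ : AtlasOn G V} {O' : Set X}
    (h : 𝒜.AgreeOn ℬ O) (hO : IsOpen O) (hO' : IsOpen O') (hsub : O' ⊆ O) : 𝒜.AgreeOn ℬ O' := by
  intro e he e' he'
  have r : ∀ f : OpenPartialHomeomorph X H, (f.restr O).restr O' ≈ f.restr O' := fun f => by
    have := restr_restr_eqOnSource f hO hO'
    rwa [inter_eq_right.2 hsub] at this
  refine ⟨?_, ?_⟩
  · exact G.mem_of_eqOnSource (G.symm_trans_restr_mem (h e he e' he').1 hO')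
      (EqOnSource.trans' (Setoid.refl _) (Setoid.symm (r e')))
  · exact G.mem_of_eqOnSource (G.symm_trans_restr_mem (h e he e' he').2 hO')
      (EqOnSource.trans' (Setoid.refl _) (Setoid.symm (r e)))

/-- If two atlases agree over an open set containing the common part of their carriers, their
charts are mutually compatible outright. [folklore] -/
theorem AgreeOn.symm_trans_mem [ClosedUnderRestriction G] {𝒜 : AtlasOn G U} {ℬ : AtlasOn G V}
    (h : 𝒜.AgreeOn ℬ O) (hO : IsOpen O) (hUV : U ∩ V ⊆ O) {e e' : OpenPartialHomeomorph X H}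
    (he : e ∈ 𝒜.charts) (he' : e' ∈ ℬ.charts) : e.symm ≫ₕ e' ∈ G := by
  refine G.symm_trans_mem_of_forall fun x hx => ⟨e'.restr O, ?_, (h e he e' he').1, ?_⟩
  · rw [restr_source' _ _ hO]
    exact ⟨hx.2, hUV ⟨𝒜.source_subset e he hx.1, ℬ.source_subset e' he' hx.2⟩⟩
  · simpa [restr_univ] using G.restr_symm_trans_restr_mem (G.symm_trans_self_mem e') hO isOpen_univ

/-- **Transitivity of agreement** over the part covered by the middle atlas: if `𝒜` agrees with
`ℬ` over `O` and `ℬ` with `𝒞` over `O`, then `𝒜` agrees with `𝒞` over `O ∩ V`, `V` the carrier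
of `ℬ` (compatibility is local). [folklore] -/
theorem AgreeOn.trans [ClosedUnderRestriction G] {𝒜 : AtlasOn G U} {ℬ : AtlasOn G V} {𝒞 : AtlasOn G W}
    (h₁ : 𝒜.AgreeOn ℬ O) (h₂ : ℬ.AgreeOn 𝒞 O) (hO : IsOpen O) : 𝒜.AgreeOn 𝒞 (O ∩ V) := by
  have hV : IsOpen V := ℬ.isOpen
  -- one direction suffices by symmetry of the statement
  suffices key : ∀ {U' W' : Set X} {𝒜' : AtlasOn G U'} {𝒞' : AtlasOn G W'}, 𝒜'.AgreeOn ℬ O → ℬ.AgreeOn 𝒞' O →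
      ∀ e ∈ 𝒜'.charts, ∀ e' ∈ 𝒞'.charts, e.symm ≫ₕ e'.restr (O ∩ V) ∈ G from
    fun e he e' he' => ⟨key h₁ h₂ e he e' he', key h₂.symm h₁.symm e' he' e he⟩
  intro U' W' 𝒜' 𝒞' h₁ h₂ e he e' he'
  refine G.symm_trans_mem_of_forall fun x hx => ?_
  rw [restr_source' _ _ (hO.inter hV)] at hx
  obtain ⟨f, hf, hxf⟩ := ℬ.cover x hx.2.2.2
  refine ⟨f.restr O, ?_, (h₁ e he f hf).1, ?_⟩
  · rw [restr_source' _ _ hO]; exact ⟨hxf, hx.2.2.1⟩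
  · -- `(f|O)⁻¹ ≫ e'|(O ∩ V)` is a restriction of `f⁻¹ ≫ e'|O ∈ G`
    have h3 : f.symm ≫ₕ e'.restr O ∈ G := (h₂ f hf e' he').1
    have h4 : (f.restr O).symm ≫ₕ (e'.restr O).restr (O ∩ V) ∈ G :=
      G.restr_symm_trans_restr_mem h3 hO (hO.inter hV)
    refine G.mem_of_eqOnSource h4 (EqOnSource.trans' (Setoid.refl _) (Setoid.symm ?_))
    have := restr_restr_eqOnSource e' hO (hO.inter hV)
    rwa [← inter_assoc, inter_self] at this

/-! #### Restriction, union, pull-back -/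

/-- **Restriction of an atlas to an open subset.** [folklore] -/
def restrict [ClosedUnderRestriction G] (𝒜 : AtlasOn G W) (O : Set X) (hO : IsOpen O) : AtlasOn G (W ∩ O) where
  charts := (fun e => e.restr O) '' 𝒜.charts
  source_subset := by
    rintro _ ⟨e, he, rfl⟩
    rw [restr_source' _ _ hO]
    exact inter_subset_inter_left _ (𝒜.source_subset e he)
  cover := by
    rintro x ⟨hxW, hxO⟩
    obtain ⟨e, he, hxe⟩ := 𝒜.cover x hxW
    exact ⟨e.restr O, mem_image_of_mem _ he, by rw [restr_source' _ _ hO]; exact ⟨hxe, hxO⟩⟩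
  compatible := by
    rintro _ ⟨e, he, rfl⟩ _ ⟨e', he', rfl⟩
    exact G.restr_symm_trans_restr_mem (𝒜.compatible e he e' he') hO hO

/-- The charts of the restricted atlas. [folklore] -/
@[simp] theorem restrict_charts [ClosedUnderRestriction G] (𝒜 : AtlasOn G W) (hO : IsOpen O) :
    (𝒜.restrict O hO).charts = (fun e => e.restr O) '' 𝒜.charts := rfl

/-- The restriction agrees with the original atlas over every open set. [folklore] -/
theorem restrict_agreeOn [ClosedUnderRestriction G] (𝒜 : AtlasOn G W) (hO : IsOpen O) {O' : Set X}
    (hO' : IsOpen O') : (𝒜.restrict O hO).AgreeOn 𝒜 O' := by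
  rintro _ ⟨e, he, rfl⟩ e' he'
  refine ⟨?_, ?_⟩
  · simpa using G.restr_symm_trans_restr_mem (𝒜.compatible e he e' he') hO hO'
  · refine G.mem_of_eqOnSource (G.symm_trans_restr_mem (𝒜.compatible e' he' e he) (hO.inter hO'))
      (EqOnSource.trans' (Setoid.refl _) (restr_restr_eqOnSource e hO hO'))

/-- **Gluing two atlases which agree on the overlap of their carriers.** [folklore] -/
def union [ClosedUnderRestriction G] (𝒜 : AtlasOn G U) (ℬ : AtlasOn G V) (h : 𝒜.AgreeOn ℬ O)
    (hO : IsOpen O) (hUV : U ∩ V ⊆ O) : AtlasOn G (U ∪ V) where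
  charts := 𝒜.charts ∪ ℬ.charts
  source_subset := by
    rintro e (he | he)
    · exact (𝒜.source_subset e he).trans subset_union_left
    · exact (ℬ.source_subset e he).trans subset_union_right
  cover := by
    rintro x (hx | hx)
    · obtain ⟨e, he, hxe⟩ := 𝒜.cover x hx; exact ⟨e, Or.inl he, hxe⟩
    · obtain ⟨e, he, hxe⟩ := ℬ.cover x hx; exact ⟨e, Or.inr he, hxe⟩
  compatible := by
    rintro e (he | he) e' (he' | he')
    · exact 𝒜.compatible e he e' he'
    · exact h.symm_trans_mem hO hUV he he'
    · exact h.symm.symm_trans_mem hO (by rwa [inter_comm]) he he'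
    · exact ℬ.compatible e he e' he'

/-- The charts of the glued atlas. [folklore] -/
@[simp] theorem union_charts [ClosedUnderRestriction G] (𝒜 : AtlasOn G U) (ℬ : AtlasOn G V)
    (h : 𝒜.AgreeOn ℬ O) (hO : IsOpen O) (hUV : U ∩ V ⊆ O) :
    (𝒜.union ℬ h hO hUV).charts = 𝒜.charts ∪ ℬ.charts := rfl

/-- Agreement with a glued atlas is agreement with both pieces. [folklore] -/
theorem agreeOn_union_iff [ClosedUnderRestriction G] {𝒜 : AtlasOn G U} {ℬ : AtlasOn G V}
    {h : 𝒜.AgreeOn ℬ O} {hO : IsOpen O} {hUV : U ∩ V ⊆ O} {𝒞 : AtlasOn G W} {O' : Set X} :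
    𝒞.AgreeOn (𝒜.union ℬ h hO hUV) O' ↔ 𝒞.AgreeOn 𝒜 O' ∧ 𝒞.AgreeOn ℬ O' := by
  constructor
  · intro hh
    exact ⟨fun e he e' he' => hh e he e' (Or.inl he'), fun e he e' he' => hh e he e' (Or.inr he')⟩
  · rintro ⟨h1, h2⟩ e he e' (he' | he')
    · exact h1 e he e' he'
    · exact h2 e he e' he'

/-- **Pull-back of an atlas along a partial homeomorphism** `φ : X' ⇀ X` (charts `φ ≫ e`): an
atlas on `φ.source ∩ φ⁻¹' W`. Reading a structure in a chart, and transporting it along a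
homeomorphism, are the cases `φ` = a chart, `φ` = a homeomorphism. [folklore] -/
def pullback [ClosedUnderRestriction G] (𝒜 : AtlasOn G W) (φ : OpenPartialHomeomorph X' X) :
    AtlasOn G (φ.source ∩ φ ⁻¹' W) where
  charts := (fun e => φ ≫ₕ e) '' 𝒜.charts
  source_subset := by
    rintro _ ⟨e, he, rfl⟩ x hx
    simp only [trans_source, mem_inter_iff, mem_preimage] at hx
    exact ⟨hx.1, 𝒜.source_subset e he hx.2⟩
  cover := by
    rintro x ⟨hx, hxW⟩
    obtain ⟨e, he, hxe⟩ := 𝒜.cover (φ x) hxW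
    exact ⟨φ ≫ₕ e, mem_image_of_mem _ he, by simp only [trans_source, mem_inter_iff, mem_preimage]; exact ⟨hx, hxe⟩⟩
  compatible := by
    rintro _ ⟨e, he, rfl⟩ _ ⟨e', he', rfl⟩
    -- `(φ ≫ e)⁻¹ ≫ (φ ≫ e') = e⁻¹ ≫ (φ⁻¹ ≫ φ) ≫ e' ≈ e⁻¹ ≫ e'|φ.target`
    have key : (φ ≫ₕ e).symm ≫ₕ (φ ≫ₕ e') ≈ e.symm ≫ₕ e'.restr φ.target := by
      rw [trans_symm_eq_symm_trans_symm, trans_assoc, ← trans_assoc φ.symm, ← ofSet_trans _ φ.open_target]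
      exact EqOnSource.trans' (Setoid.refl _) ((symm_trans_self φ).trans' (Setoid.refl _))
    exact G.mem_of_eqOnSource (G.symm_trans_restr_mem (𝒜.compatible e he e' he') φ.open_target) key

/-- The charts of the pulled-back atlas. [folklore] -/
@[simp] theorem pullback_charts [ClosedUnderRestriction G] (𝒜 : AtlasOn G W) (φ : OpenPartialHomeomorph X' X) :
    (𝒜.pullback φ).charts = (fun e => φ ≫ₕ e) '' 𝒜.charts := rfl

/-- **Pull-back preserves agreement**: if `𝒜` and `ℬ` agree over `O` then their pull-backs
along `φ` agree over `φ.source ∩ φ⁻¹' O`. [folklore] -/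
theorem AgreeOn.pullback [ClosedUnderRestriction G] {𝒜 : AtlasOn G U} {ℬ : AtlasOn G V}
    (h : 𝒜.AgreeOn ℬ O) (hO : IsOpen O) (φ : OpenPartialHomeomorph X' X) :
    (𝒜.pullback φ).AgreeOn (ℬ.pullback φ) (φ.source ∩ φ ⁻¹' O) := by
  have hO' : IsOpen (φ.source ∩ φ ⁻¹' O) := φ.isOpen_inter_preimage hO
  -- one direction, for arbitrary atlases
  suffices key : ∀ {U' V' : Set X} {𝒜' : AtlasOn G U'} {ℬ' : AtlasOn G V'}, 𝒜'.AgreeOn ℬ' O →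
      ∀ e ∈ 𝒜'.charts, ∀ e' ∈ ℬ'.charts, (φ ≫ₕ e).symm ≫ₕ (φ ≫ₕ e').restr (φ.source ∩ φ ⁻¹' O) ∈ G by
    rintro _ ⟨e, he, rfl⟩ _ ⟨e', he', rfl⟩
    exact ⟨key h e he e' he', key h.symm e' he' e he⟩
  intro U' V' 𝒜' ℬ' h e he e' he'
  have h1 : e.symm ≫ₕ (e'.restr O).restr φ.target ∈ G := G.symm_trans_restr_mem (h e he e' he').1 φ.open_target
  refine G.mem_of_eqOnSource h1 ?_
  -- both sides are `e' ∘ e⁻¹` on `{y ∈ e.target | e⁻¹ y ∈ φ.target ∩ O ∩ e'.source}`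
  constructor
  · ext y
    simp only [trans_source, symm_source, trans_target, coe_trans_symm, Function.comp_apply,
      mem_inter_iff, mem_preimage, restr_source' _ _ hO', restr_source' _ _ hO, restr_source' _ _ φ.open_target]
    constructor
    · rintro ⟨⟨hy, hyt⟩, ⟨hφ, he'⟩, hφ', hO⟩
      rw [φ.right_inv hyt] at he' hO
      exact ⟨hy, ⟨he', hO⟩, hyt⟩
    · rintro ⟨hy, ⟨he', hO⟩, hyt⟩
      refine ⟨⟨hy, hyt⟩, ⟨φ.map_target hyt, ?_⟩, φ.map_target hyt, ?_⟩
      · rw [φ.right_inv hyt]; exact he'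
      · rw [φ.right_inv hyt]; exact hO
  · intro y hy
    simp only [trans_source, symm_source, trans_target, coe_trans_symm, mem_inter_iff, mem_preimage] at hy
    simp only [coe_trans, coe_trans_symm, Function.comp_apply, restr_apply]
    rw [φ.right_inv hy.1.2]

/-! #### Locally eventually constant families -/

section Limit

variable {ι : Type*} [Preorder ι]

/-- **Gluing a locally eventually constant family of atlases.** Let `𝒜 i` be atlases on `W i`,
and suppose every point `x` of `S` has an index `N x` and an open neighbourhood `V x ⊆ W (N x)`
such that for all `i ≥ N x`, `V x ⊆ W i` and `𝒜 i` agrees with `𝒜 (N x)` over `V x`. Then the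
restrictions `e|V x` (`x ∈ S`, `e ∈ 𝒜 (N x)`) form an atlas on `⋃ x ∈ S, V x` (Hatcher 2013,
proof of Thm. A; Milnor 1965, proof of Thm. 2.7). [folklore] -/
def limit [ClosedUnderRestriction G] [IsDirected ι (· ≤ ·)] {W : ι → Set X} (𝒜 : ∀ i, AtlasOn G (W i))
    {S : Set X} (N : X → ι) (V : X → Set X) (hV : ∀ x ∈ S, IsOpen (V x)) (hVW : ∀ x ∈ S, ∀ i, N x ≤ i → V x ⊆ W i)
    (hagree : ∀ x ∈ S, ∀ i, N x ≤ i → (𝒜 i).AgreeOn (𝒜 (N x)) (V x)) :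
    AtlasOn G (⋃ x ∈ S, V x) where
  charts := ⋃ x ∈ S, (fun e => e.restr (V x)) '' (𝒜 (N x)).charts
  source_subset := by
    intro e he
    simp only [mem_iUnion, mem_image] at he
    obtain ⟨x, hx, f, hf, rfl⟩ := he
    rw [restr_source' _ _ (hV x hx)]
    exact inter_subset_right.trans (subset_iUnion₂ (s := fun x _ => V x) x hx)
  cover := by
    intro y hy
    obtain ⟨x, hx, hyx⟩ := mem_iUnion₂.1 hy
    obtain ⟨f, hf, hyf⟩ := (𝒜 (N x)).cover y (hVW x hx (N x) le_rfl hyx)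
    refine ⟨f.restr (V x), mem_iUnion₂.2 ⟨x, hx, mem_image_of_mem _ hf⟩, ?_⟩
    rw [restr_source' _ _ (hV x hx)]; exact ⟨hyf, hyx⟩
  compatible := by
    intro e he e' he'
    simp only [mem_iUnion, mem_image] at he he'
    obtain ⟨x, hx, f, hf, rfl⟩ := he
    obtain ⟨x', hx', f', hf', rfl⟩ := he'
    obtain ⟨k, hk, hk'⟩ := directed_of (· ≤ ·) (N x) (N x')
    -- both restricted charts are compatible with `𝒜 k` over `V x ∩ V x'`, which `𝒜 k` covers
    refine G.symm_trans_mem_of_forall fun y hy => ?_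
    rw [restr_source' _ _ (hV x hx), restr_source' _ _ (hV x' hx')] at hy
    obtain ⟨g, hg, hyg⟩ := (𝒜 k).cover y (hVW x hx k hk hy.1.2)
    refine ⟨g.restr (V x ∩ V x'), ?_, ?_, ?_⟩
    · rw [restr_source' _ _ ((hV x hx).inter (hV x' hx'))]; exact ⟨hyg, hy.1.2, hy.2.2⟩
    · -- `(f|Vx)⁻¹ ≫ g|(Vx ∩ Vx')` from `f⁻¹ ≫ g|Vx ∈ G`
      have h1 : f.symm ≫ₕ g.restr (V x) ∈ G := ((hagree x hx k hk) g hg f hf).2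
      have h2 := G.restr_symm_trans_restr_mem h1 (hV x hx) ((hV x hx).inter (hV x' hx'))
      refine G.mem_of_eqOnSource h2 (EqOnSource.trans' (Setoid.refl _) (Setoid.symm ?_))
      have := restr_restr_eqOnSource g (hV x hx) ((hV x hx).inter (hV x' hx'))
      rwa [← inter_assoc, inter_self] at this
    · have h1 : g.symm ≫ₕ f'.restr (V x') ∈ G := ((hagree x' hx' k hk') g hg f' hf').1
      have h2 := G.restr_symm_trans_restr_mem h1 ((hV x hx).inter (hV x' hx')) (hV x' hx')
      refine G.mem_of_eqOnSource h2 (EqOnSource.trans' (Setoid.refl _) (Setoid.symm ?_))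
      have := restr_restr_eqOnSource f' (hV x' hx') (hV x' hx')
      rwa [inter_self] at this

/-- The charts of the limit atlas. [folklore] -/
theorem limit_charts [ClosedUnderRestriction G] [IsDirected ι (· ≤ ·)] {W : ι → Set X} (𝒜 : ∀ i, AtlasOn G (W i))
    {S : Set X} (N : X → ι) (V : X → Set X) (hV : ∀ x ∈ S, IsOpen (V x)) (hVW : ∀ x ∈ S, ∀ i, N x ≤ i → V x ⊆ W i)
    (hagree : ∀ x ∈ S, ∀ i, N x ≤ i → (𝒜 i).AgreeOn (𝒜 (N x)) (V x)) :
    (limit 𝒜 N V hV hVW hagree).charts = ⋃ x ∈ S, (fun e => e.restr (V x)) '' (𝒜 (N x)).charts := rfl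

/-- **The limit atlas agrees with the stages**: over `V x` it agrees with `𝒜 i` for every
`i ≥ N x`. [folklore] -/
theorem limit_agreeOn [ClosedUnderRestriction G] [IsDirected ι (· ≤ ·)] {W : ι → Set X} (𝒜 : ∀ i, AtlasOn G (W i))
    {S : Set X} (N : X → ι) (V : X → Set X) (hV : ∀ x ∈ S, IsOpen (V x)) (hVW : ∀ x ∈ S, ∀ i, N x ≤ i → V x ⊆ W i)
    (hagree : ∀ x ∈ S, ∀ i, N x ≤ i → (𝒜 i).AgreeOn (𝒜 (N x)) (V x)) {x : X} (hx : x ∈ S) {i : ι} (hi : N x ≤ i) :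
    (limit 𝒜 N V hV hVW hagree).AgreeOn (𝒜 i) (V x) := by
  intro e he e' he'
  simp only [limit_charts, mem_iUnion, mem_image] at he
  obtain ⟨x₀, hx₀, f, hf, rfl⟩ := he
  obtain ⟨k, hk, hk'⟩ := directed_of (· ≤ ·) (N x₀) i
  have hVx : IsOpen (V x) := hV x hx
  have hVx₀ : IsOpen (V x₀) := hV x₀ hx₀
  have hVV : IsOpen (V x₀ ∩ V x) := hVx₀.inter hVx
  -- `𝒜 k` agrees with `𝒜 i` over `V x` (both agree with `𝒜 (N x)` there, and `V x ⊆ W (N x)`)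
  have hki : (𝒜 k).AgreeOn (𝒜 i) (V x) := by
    have h1 := (hagree x hx k (hi.trans hk')).trans (hagree x hx i hi).symm hVx
    have heq : V x ∩ W (N x) = V x := inter_eq_left.2 (hVW x hx (N x) le_rfl)
    rwa [heq] at h1
  refine ⟨G.symm_trans_mem_of_forall fun y hy => ?_, G.symm_trans_mem_of_forall fun y hy => ?_⟩
  · rw [restr_source' _ _ hVx₀, restr_source' _ _ hVx] at hy
    obtain ⟨g, hg, hyg⟩ := (𝒜 k).cover y (hVW x₀ hx₀ k hk hy.1.2)
    refine ⟨g.restr (V x₀ ∩ V x), ?_, ?_, ?_⟩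
    · rw [restr_source' _ _ hVV]; exact ⟨hyg, hy.1.2, hy.2.2⟩
    · have h1 : f.symm ≫ₕ g.restr (V x₀) ∈ G := ((hagree x₀ hx₀ k hk) g hg f hf).2
      have h2 := G.restr_symm_trans_restr_mem h1 hVx₀ hVV
      refine G.mem_of_eqOnSource h2 (EqOnSource.trans' (Setoid.refl _) (Setoid.symm ?_))
      have := restr_restr_eqOnSource g hVx₀ hVV
      rwa [← inter_assoc, inter_self] at this
    · have h1 : g.symm ≫ₕ e'.restr (V x) ∈ G := (hki g hg e' he').1
      have h2 := G.restr_symm_trans_restr_mem h1 hVV hVx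
      refine G.mem_of_eqOnSource h2 (EqOnSource.trans' (Setoid.refl _) (Setoid.symm ?_))
      have := restr_restr_eqOnSource e' hVx hVx
      rwa [inter_self] at this
  · simp only [restr_source' _ _ hVx, restr_source' _ _ hVx₀, mem_inter_iff] at hy
    obtain ⟨g, hg, hyg⟩ := (𝒜 k).cover y (hVW x₀ hx₀ k hk hy.2.1.2)
    refine ⟨g.restr (V x₀ ∩ V x), ?_, ?_, ?_⟩
    · rw [restr_source' _ _ hVV]; exact ⟨hyg, hy.2.1.2, hy.2.2⟩
    · have h1 : e'.symm ≫ₕ g.restr (V x) ∈ G := (hki g hg e' he').2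
      have h2 := G.symm_trans_restr_mem h1 hVV
      refine G.mem_of_eqOnSource h2 (EqOnSource.trans' (Setoid.refl _) (Setoid.symm ?_))
      have := restr_restr_eqOnSource g hVx hVV
      rwa [inter_comm (V x₀), ← inter_assoc, inter_self, inter_comm] at this
    · have h1 : g.symm ≫ₕ f.restr (V x₀) ∈ G := ((hagree x₀ hx₀ k hk) g hg f hf).1
      exact G.restr_symm_trans_restr_mem h1 hVV hVx

end Limit

end AtlasOn

end Literature.Geometry.Manifold

end
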